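import Literature.IUT.HodgeArakelov.BadPrimeGaussianMonoidsSymmetrizingSectionsProofs
import Literature.IUT.HodgeArakelov.CohomologyLimitCongr

/-!
# [IUTchII] Cor 3.5 (ii) "⥤", LABEL-WISE form: `hr`, `hfix`, `hs` DISCHARGED at the cohomology model for an
# ARBITRARY family of evaluation sections `s_t : G_v → Π_X(M^Θ_*)` (one per label, images `D_{t,μ_-} ⊆ Π_Ÿ`) — no
# conjugating elements, no normalisation beyond `Π_Ÿ ⊴ Π_X` (proof-only sequel to `…CohomologyModelProofs2.lean`,
# answering RQ7 Q1 of abc-iut-w4-d017 on p417978)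

S. Mochizuki, *Inter-universal Teichmüller theory II*, kurims Dec-2020 manuscript, Cor 3.5 (ii) p. 95: "`↞` denotes
the compatibility of the action of `G_v(M^Θ_*▶)_{|t|}` on the factor labeled `|t|` of the direct product … with the
inclusions `G_v(M^Θ_*) ↪ Π_{v▶}(M^Θ_*▶)` determined by the various choices of the `D^δ_{t,μ_-}` [cf. Corollary 2.8,
(i), (ii)] that gave rise to the value-profile `ξ`"; Cor 2.4 (ii)(c) p. 70 ("`D^δ_{t,μ_-} ⊆ Π^δ_{v□̈}` … the image
of an evaluation section"); Rmk 3.5.1 (i) p. 96 (`γ = 1` in Cor 3.5); Prop 1.4 p. 27 (`Π_Ÿ(Π) ⊆ Π`)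
[cite: Mochizuki2012, Cor 3.5 (ii) p.95]. Claim key DISPUTED (D-0012). PROOF-ONLY companion (abc-iut cell, layer
L6, seat abc-iut-w4-d004 gen 2; node **IUTchII:Cor3.5(ii)**, Galois clause; sub-DAG row Cor-35.ii.r10). NO
definition, NO `Prop` fact.

WHY THIS FILE. `…CohomologyModelProofs2` presented the labelled sections as conjugates `γ_t ι γ_t⁻¹` of ONE
evaluation section by elements `γ_t ∈ P ⊵ Π_Ÿ`; as abc-iut-w4-d017's RQ7 question Q1 (STATUS 02:59:24Z) observes,
at the intended model this covers the `Π_X(M^Θ_*)`-conjugate sections (Rmk 3.5.1 (ii)) and the `Π̂^±_v`-part but NOT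
the cross-label `𝔽_l^{⋊±}`-moves `δ ∈ Π̂^cor_v ∖ Π̂^±_v`, since `Π_v ⋬ Π^cor_v` (Rmk 2.3.1). HERE the model is the
faithful label-wise one: EVERY label `t` carries its OWN continuous section `ι_t = j ∘ s_t : Π₀ ≅ G_v → Π` with
image in `N = Π_Ÿ` (Cor 2.4 (ii)(c)); the restriction `r_t` is the pull-back `ι_t^*` (`h1LimComap`, abc-iut-w4-d004
p417002) into `lim_{K₀} H¹(Π₀ ⊓ K₀, A)` computed with the coefficient action `φ ∘ ι_t` — EQUAL, for every label, to
the common `G_v`-action `φ₀` on the cyclotome (the action of `Π` on `Π_μ ≅ Ẑ(1)` factors through `Π ↠ G_v`, of which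
the `ι_t` are sections) — followed by the transport `h1LimCongr` along that equality (p420011) into the SINGLE labeled
copy module `lim_{K₀} H¹(Π₀ ⊓ K₀, A)_{φ₀}` with its own conjugation action `β = h1LimConjMulAut φ₀`:
* `h1LimCongr_comap_conj` — **`hr` at the model, label-wise**: `r_t (conj (ι_t g) y) = β_g (r_t y)` for every label;
* `restriction_conj_section_eq_labelwise`, `conj_section_eq_self_labelwise` — transport to any `ThetaEnvData`
  identified with the model (`j`, `ψ` equivariant; restrictions `R_t` PINNED to `h1LimCongr ∘ ι_t^* ∘ ψ`): `hr` and
  `hfix` (via p417515, from `ι_t(Π₀) ≤ Π_Ÿ`) HOLD;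
* `sections_mk_eq_of_isSection` — `hs` ("the sections agree modulo `Δ`") from: the `s_t` are SECTIONS of an
  augmentation `q : Π_X(M^Θ_*) → G` with `Ker q ≤ Δ` up to one fixed identification `w : Π₀ → G` (`q ∘ s_t = w`); and
  `sections_mk_eq_of_isSection_aug` — the same with `q :=` the reference augmentation `Π^tp_{X̲̲_v} ↠ G_v` read through
  ANY identification `f : Π_X(M^Θ_*) ≅ Π^tp_{X̲̲_v}` and `Δ := AbsTopMonoids.Delta` (abc-iut-w4-d004
  `AbsTopMonoids.mem_Delta_iff_aug_eq_one`, p419140);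
* `mrange_pi_diagonalStable'_ofCohomologyModel_labelwise` (+ `…_of_isSection_aug`) — **"each `Ψ_ξ(M^Θ_*)` is
  equipped with a natural action by `G_v(M^Θ_*▶)_{⟨F_l^⋇⟩}`"** (restrictions out of the theta monoid, typing of record)
  with `hr`, `hfix` (and `hs`) DISCHARGED for ARBITRARY label-wise sections; residual = Kummer datum (G-w4d019-1),
  model identification `(j, ψ)`, the common-action equalities `φ ∘ ι_t = φ₀`, `ι_t(Π₀) ≤ Π_Ÿ`, `θ` top-level
  (structural at the produced record, p418953), and (for `…_of_isSection_aug`) `aug ∘ f ∘ s_t = w`;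
* `pi_restriction_inftyThetaMonoid_upToTorsion_ofCohomologyModel_labelwise` — the `∞`-level (Rmk 3.6.1) in
  abc-iut-w5-d131's faithful torsion form, label-wise.

Nothing here asserts a disputed claim or takes a side on [IUTchIII] Cor 3.12; typed ≠ proved ≠ endorsed.
-/

namespace Literature.IUT.HodgeArakelov

namespace BadPrimeGaussianMonoids

open Literature.AnabelianGeometry.EtaleTheta CohomologySystemOfContH1 TemperedThetaMonoids

universe u v

/-! ### 1. `hr` at the model for a family of evaluation sections -/

section Model

variable {P₀ P : TopGroup.{u}} {G' : Type u} [Group G'] [TopologicalSpace G'] [IsTopologicalGroup G']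
  (φ : P →* G') (φ₀ : P₀ →* G') (A : Subgroup G') [A.Normal] [IsMulCommutative A] (N : Subgroup P) [N.Normal]
  {L : Type*} (ι : L → (P₀ →* P))

/-- **IUTchII:Cor3.5(ii)** `hr` AT THE MODEL, label-wise: for the restriction
`r_t := h1LimCongr (φ ∘ ι_t = φ₀) ∘ ι_t^*` along the evaluation section of label `t` into the common labeled copy
`lim_{K₀} H¹(Π₀ ⊓ K₀, A)_{φ₀}`, `r_t (conj (ι_t g) y) = conj_g (r_t y)` (abc-iut-w4-d004 `h1LimComap_conj` +
`h1LimCongr_conj`). [cite: Mochizuki2012, Cor 3.5 (ii) p.95] -/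
theorem h1LimCongr_comap_conj (hι : ∀ t, Continuous (ι t)) (hN : ∀ t, (⊤ : Subgroup P₀).map (ι t) ≤ N)
    (hφ : ∀ t, φ.comp (ι t) = φ₀) (t : L) (g : P₀) (y : h1Lim φ A N ⊥) :
    h1LimCongr A ⊤ (hφ t) ⊥ (h1LimComap φ A (ι t) (hι t) (hN t) (h1LimConj φ A N (ι t g) y)) =
      h1LimConj φ₀ A ⊤ g (h1LimCongr A ⊤ (hφ t) ⊥ (h1LimComap φ A (ι t) (hι t) (hN t) y)) := by
  rw [h1LimComap_conj, h1LimCongr_conj]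

omit [N.Normal] in
/-- The sections land in `N = Π_Ÿ` elementwise (Cor 2.4 (ii)(c) `D_{t,μ_-} ⊆ Π_Ÿ`), the membership behind `hfix`.
[cite: Mochizuki2012, Cor 2.4 (ii) p.70] -/
theorem section_apply_mem (hN : ∀ t, (⊤ : Subgroup P₀).map (ι t) ≤ N) (t : L) (g : P₀) : ι t g ∈ N :=
  hN t ⟨g, Subgroup.mem_top g, rfl⟩

end Model

/-! ### 2. Transport to a `ThetaEnvData` identified with the model; `hs` from sections -/

section Transport

variable {Q : Type u} [Group Q] (E : TemperedThetaMonoids.ThetaEnvData.{u, v} Q)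
  {P₀ P : TopGroup.{u}} {G' : Type u} [Group G'] [TopologicalSpace G'] [IsTopologicalGroup G']
  (φ : P →* G') (φ₀ : P₀ →* G') (A : Subgroup G') [A.Normal] [IsMulCommutative A] (N : Subgroup P) [N.Normal]
  (j : Q →* P) (ψ : Additive E.H ≃+ h1Lim φ A N ⊥) {L : Type*} (s : L → (P₀ →* Q))

/-- **IUTchII:Cor3.5(ii)** `hr` DERIVED, label-wise, for a `ThetaEnvData` identified with the model (`ψ` equivariant
along `j`): restriction morphisms `R_t` pinned to `h1LimCongr ∘ (j ∘ s_t)^* ∘ ψ` are equivariant along the sections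
`s_t` for the labeled `G_v`-action `h1LimConjMulAut φ₀`. [cite: Mochizuki2012, Cor 3.5 (ii) p.95] -/
theorem restriction_conj_section_eq_labelwise (hι : ∀ t, Continuous (j.comp (s t)))
    (hN : ∀ t, (⊤ : Subgroup P₀).map (j.comp (s t)) ≤ N) (hφ : ∀ t, φ.comp (j.comp (s t)) = φ₀)
    (hψ : ∀ (p : Q) (y : E.H), ψ (Additive.ofMul (E.conj p y)) = h1LimConj φ A N (j p) (ψ (Additive.ofMul y)))
    (R : L → (E.H →* Multiplicative (h1Lim φ₀ A (⊤ : Subgroup P₀) ⊥)))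
    (hR : ∀ t y, Multiplicative.toAdd (R t y) =
      h1LimCongr A ⊤ (hφ t) ⊥ (h1LimComap φ A (j.comp (s t)) (hι t) (hN t) (ψ (Additive.ofMul y))))
    (t : L) (g : P₀) (y : E.H) :
    R t (E.conj (s t g) y) = h1LimConjMulAut φ₀ A ⊤ g (R t y) := by
  apply Multiplicative.toAdd.injective
  rw [h1LimConjMulAut_apply, toAdd_ofAdd, hR, hR, hψ]
  exact h1LimCongr_comap_conj φ φ₀ A N (fun t => j.comp (s t)) hι hN hφ t g _

/-- **IUTchII:Cor3.5(ii)** `hfix`, label-wise: every `s_t(g)` lands in `Π_Ÿ`, so (p417515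
`conj_section_eq_self_ofTopClass`) it fixes every top-level class `θ`. [cite: Mochizuki2012, Cor 3.5 (ii) p.95] -/
theorem conj_section_eq_self_labelwise (hN : ∀ t, (⊤ : Subgroup P₀).map (j.comp (s t)) ≤ N)
    (hψ : ∀ (p : Q) (y : E.H), ψ (Additive.ofMul (E.conj p y)) = h1LimConj φ A N (j p) (ψ (Additive.ofMul y)))
    {θ : E.H} (hθ : ψ (Additive.ofMul θ) ∈ Set.range ((cohomologySystemOfContH1 φ A N).toLim ⊤)) :
    ∀ g t, E.conj (s t g) θ = θ :=
  conj_section_eq_self_ofTopClass E φ A N j ψ hψ s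
    (fun t g => section_apply_mem N (fun t => j.comp (s t)) hN t g) hθ

omit [N.Normal] in
/-- **IUTchII:Cor3.5(i)** (kurims p.94 "independent of `|t|`") — `hs` from SECTIONS: if the `s_t` are sections of an
augmentation `q : Π_X(M^Θ_*) → G` with `Ker q ≤ Δ`, up to one fixed identification `w : Π₀ → G` (`q ∘ s_t = w` for
all `t`), then `s_t(g) ≡ s_{t'}(g) mod Δ`. [cite: Mochizuki2012, Cor 3.5 (i) p.94] -/
theorem sections_mk_eq_of_isSection {K : Type*} [Group K] (q : Q →* K) (Δ : Subgroup Q)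
    (hΔ : ∀ x : Q, q x = 1 → x ∈ Δ) (w : P₀ →* K) (hsec : ∀ t g, q (s t g) = w g) (t t' : L) (g : P₀) :
    (QuotientGroup.mk (s t g) : Q ⧸ Δ) = QuotientGroup.mk (s t' g) := by
  rw [QuotientGroup.eq]
  apply hΔ
  rw [map_mul, map_inv, hsec, hsec, inv_mul_cancel]

end Transport

/-! ### 3. The Galois clause with `hr`, `hfix` (and `hs`) discharged for arbitrary label-wise sections -/

section Assembly

variable {S : ThetaSetting.{u}} (A : AbsTopMonoids S) (Pc : IsoClass S.PiX)
  (E : TemperedThetaMonoids.ThetaEnvData.{u, v} Pc.G) (κ : A.MTM Pc →* E.H) {L : Type*}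
  {P₀ P : TopGroup.{u}} {G' : Type u} [Group G'] [TopologicalSpace G'] [IsTopologicalGroup G']
  (φ : P →* G') (φ₀ : P₀ →* G') (Am : Subgroup G') [Am.Normal] [IsMulCommutative Am] (N : Subgroup P) [N.Normal]
  (j : Pc.G →* P) (ψ : Additive E.H ≃+ h1Lim φ Am N ⊥) (s : L → (P₀ →* Pc.G))
  (hι : ∀ t, Continuous (j.comp (s t))) (hN : ∀ t, (⊤ : Subgroup P₀).map (j.comp (s t)) ≤ N)
  (hφ : ∀ t, φ.comp (j.comp (s t)) = φ₀)

/-- **IUTchII:Cor3.5(ii)** (kurims p.95) "each `Ψ_ξ(M^Θ_*)` is equipped with a natural action by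
`G_v(M^Θ_*▶)_{⟨F_l^⋇⟩}`" — restrictions out of the theta monoid (typing of record), **`hr` and `hfix` DISCHARGED at the
cohomology model for an ARBITRARY family of evaluation sections** `s_t : Π₀ → Π_X(M^Θ_*)` (continuous into `Π`,
images in `Π_Ÿ`, common coefficient action `φ₀`). Hypotheses: Kummer data of Prop 3.1 (ii) (G-w4d019-1), sections
agreeing modulo `Δ` (`hs`), model identification `(j, ψ)`, `θ` top-level, restrictions pinned to
`h1LimCongr ∘ (j ∘ s_t)^* ∘ ψ`. [cite: Mochizuki2012, Cor 3.5 (ii) p.95] -/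
theorem mrange_pi_diagonalStable'_ofCohomologyModel_labelwise (hκ : Function.Injective κ)
    (hcns : E.constantMonoid = MonoidHom.mrange κ)
    (hκeq : ∀ (x : Pc.G) (m : A.MTM Pc), κ (A.actMTM Pc x m) = E.conj x (κ m))
    (hs : ∀ t t' g, (QuotientGroup.mk (s t g) : Pc.G ⧸ A.Delta Pc) = QuotientGroup.mk (s t' g))
    (hψ : ∀ (p : Pc.G) (y : E.H),
      ψ (Additive.ofMul (E.conj p y)) = h1LimConj φ Am N (j p) (ψ (Additive.ofMul y)))
    (θ : E.H) (hθ : ψ (Additive.ofMul θ) ∈ Set.range ((cohomologySystemOfContH1 φ Am N).toLim ⊤))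
    (R : L → (E.H →* Multiplicative (h1Lim φ₀ Am (⊤ : Subgroup P₀) ⊥)))
    (hR : ∀ t y, Multiplicative.toAdd (R t y) =
      h1LimCongr Am ⊤ (hφ t) ⊥ (h1LimComap φ Am (j.comp (s t)) (hι t) (hN t) (ψ (Additive.ofMul y))))
    (t₀ : L) (g : P₀) :
    (MonoidHom.mrange (MonoidHom.pi fun t =>
        (R t).comp (splitMonoid E.units (Submonoid.powers θ)).subtype)).map
        (piIso L (h1LimConjMulAut φ₀ Am ⊤ g)).toMonoidHom =
      MonoidHom.mrange (MonoidHom.pi fun t => (R t).comp (splitMonoid E.units (Submonoid.powers θ)).subtype) :=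
  mrange_pi_diagonalStable'_of_kummer_of_fixed A Pc E κ hκ hcns hκeq s hs (h1LimConjMulAut φ₀ Am ⊤) θ
    (conj_section_eq_self_labelwise E φ Am N j ψ s hN hψ hθ) _
    (fun t g' x => restriction_conj_section_eq_labelwise E φ φ₀ Am N j ψ s hι hN hφ hψ R hR t g' (x : E.H)) t₀ g

/-- **IUTchII:Cor3.5(ii)** (kurims p.95), the headline with `hs` ALSO discharged from "the `s_t` are sections of the
reference augmentation `Π_X(M^Θ_*) ≅ Π^tp_{X̲̲_v} ↠ G_v`" (read through ANY identification `f`, up to one fixed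
identification `w : Π₀ → G_v`; `Δ = Ker` by abc-iut-w4-d004 `AbsTopMonoids.mem_Delta_iff_aug_eq_one`): NO junction
hypothesis of the Galois clause remains, for arbitrary label-wise evaluation sections.
[cite: Mochizuki2012, Cor 3.5 (ii) p.95] -/
theorem mrange_pi_diagonalStable'_ofCohomologyModel_labelwise_of_isSection_aug (hκ : Function.Injective κ)
    (hcns : E.constantMonoid = MonoidHom.mrange κ)
    (hκeq : ∀ (x : Pc.G) (m : A.MTM Pc), κ (A.actMTM Pc x m) = E.conj x (κ m))
    (f : Pc ⟶ IsoClass.base S.PiX) (w : P₀ →* S.Gk) (hsec : ∀ t g, S.aug (IsoClass.homIso f (s t g)) = w g)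
    (hψ : ∀ (p : Pc.G) (y : E.H),
      ψ (Additive.ofMul (E.conj p y)) = h1LimConj φ Am N (j p) (ψ (Additive.ofMul y)))
    (θ : E.H) (hθ : ψ (Additive.ofMul θ) ∈ Set.range ((cohomologySystemOfContH1 φ Am N).toLim ⊤))
    (R : L → (E.H →* Multiplicative (h1Lim φ₀ Am (⊤ : Subgroup P₀) ⊥)))
    (hR : ∀ t y, Multiplicative.toAdd (R t y) =
      h1LimCongr Am ⊤ (hφ t) ⊥ (h1LimComap φ Am (j.comp (s t)) (hι t) (hN t) (ψ (Additive.ofMul y))))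
    (t₀ : L) (g : P₀) :
    (MonoidHom.mrange (MonoidHom.pi fun t =>
        (R t).comp (splitMonoid E.units (Submonoid.powers θ)).subtype)).map
        (piIso L (h1LimConjMulAut φ₀ Am ⊤ g)).toMonoidHom =
      MonoidHom.mrange (MonoidHom.pi fun t => (R t).comp (splitMonoid E.units (Submonoid.powers θ)).subtype) :=
  mrange_pi_diagonalStable'_ofCohomologyModel_labelwise A Pc E κ φ φ₀ Am N j ψ s hι hN hφ hκ hcns hκeq
    (sections_mk_eq_of_isSection s (S.aug.comp (IsoClass.homIso f).toMulEquiv.toMonoidHom) (A.Delta Pc)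
      (fun x hx => (AbsTopMonoids.mem_Delta_iff_aug_eq_one A Pc f x).mpr hx) w (fun t g' => hsec t g'))
    hψ θ hθ R hR t₀ g

/-- **IUTchII:Cor3.5(ii)** / **IUTchII:Rmk3.6.1** at the `∞`-level, label-wise: abc-iut-w5-d131's faithful torsion
form with `hr`, `hfix` discharged for arbitrary label-wise sections and `hs` from the sections property.
[cite: Mochizuki2012, Rmk 3.6.1 p.101] -/
theorem pi_restriction_inftyThetaMonoid_upToTorsion_ofCohomologyModel_labelwise (hκ : Function.Injective κ)
    (hcns : E.constantMonoid = MonoidHom.mrange κ)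
    (hκeq : ∀ (x : Pc.G) (m : A.MTM Pc), κ (A.actMTM Pc x m) = E.conj x (κ m))
    (f : Pc ⟶ IsoClass.base S.PiX) (w : P₀ →* S.Gk) (hsec : ∀ t g, S.aug (IsoClass.homIso f (s t g)) = w g)
    (hψ : ∀ (p : Pc.G) (y : E.H),
      ψ (Additive.ofMul (E.conj p y)) = h1LimConj φ Am N (j p) (ψ (Additive.ofMul y)))
    (i₀ : E.Iota) (θ : E.H) (hθ : ψ (Additive.ofMul θ) ∈ Set.range ((cohomologySystemOfContH1 φ Am N).toLim ⊤))
    (hroots : ∀ ϑ ∈ E.inftyThetaEnv i₀, ∃ n : ℕ, 0 < n ∧ ϑ ^ n ∈ splitMonoid E.units (Submonoid.powers θ))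
    (htors : ∀ u : E.H, IsOfFinOrder u → u ∈ E.units)
    (R : L → (E.H →* Multiplicative (h1Lim φ₀ Am (⊤ : Subgroup P₀) ⊥)))
    (hR : ∀ t y, Multiplicative.toAdd (R t y) =
      h1LimCongr Am ⊤ (hφ t) ⊥ (h1LimComap φ Am (j.comp (s t)) (hι t) (hN t) (ψ (Additive.ofMul y))))
    (t₀ : L) (g : P₀) (x : E.H) (hx : x ∈ E.inftyThetaMonoid i₀) :
    ∃ u : L → E.H, (∀ t, u t ∈ E.units ∧ IsOfFinOrder (u t)) ∧
      MonoidHom.pi R (E.conj (s t₀ g) x) =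
        (fun t => R t (u t)) * piIso L (h1LimConjMulAut φ₀ Am ⊤ g) (MonoidHom.pi R x) :=
  pi_restriction_inftyThetaMonoid_upToTorsion_of_kummer_of_fixed A Pc E κ hκ hcns hκeq s
    (sections_mk_eq_of_isSection s (S.aug.comp (IsoClass.homIso f).toMulEquiv.toMonoidHom) (A.Delta Pc)
      (fun x hx => (AbsTopMonoids.mem_Delta_iff_aug_eq_one A Pc f x).mpr hx) w (fun t g' => hsec t g'))
    (h1LimConjMulAut φ₀ Am ⊤) R
    (fun t g' y => restriction_conj_section_eq_labelwise E φ φ₀ Am N j ψ s hι hN hφ hψ R hR t g' y) i₀ θ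
    (conj_section_eq_self_labelwise E φ Am N j ψ s hN hψ hθ) hroots htors t₀ g x hx

end Assembly

end BadPrimeGaussianMonoids

end Literature.IUT.HodgeArakelov
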